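import Summits.ResolutionOfSingularities.ResolutionOfSingularities.Theorems.MarkedTransferCampaignW46MohWindowShadePSModel
import Summits.ResolutionOfSingularities.ResolutionOfSingularities.Theorems.MarkedTransferCampaignW46MohWindowShadeFormalNRChart
import Literature.AlgebraicGeometry.Resolution.PointBlowupDirectrixBaseChange
import HarnessLib

/-!
# [OURS · L1 W4.6 rung (iii-2), NON-RATIONAL POINTS, model side] The shade model commutes with extension of the coefficient field

Cell `res-hironaka`, LADDER-RESOLUTION rung L (D-0089), slot W4.6 rung (iii); seat res-L1-s46-pv-6 (gen 7). Host route MarkedTransfer,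
`--supports stmt-ResolutionOfSingularities-16155 --as helper`; kind proof (no definition). For an (injective) homomorphism of fields
`f : K → K′` and a `K`-rational point `b` of the chart `y_j`: the Hauser–Wagner step of the POLYNOMIAL model (`PointBlowup.step`: chart transform,
translation, deletion of `p`-th power monomials, new multiplicities) and of the POWER-SERIES model (`MohWindowShadePS.Series.step`, defined
coefficientwise from the polynomial step on truncations, p540070) commute with `F ↦ F ⊗ K′`, and «equimultiple point» is invariant
(`PointBlowup.pointTransform_map_ringHom` / `isEquimultiplePoint_map_ringHom_iff` of the tree's `PointBlowupDirectrixBaseChange.lean` do the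
chart transform and the translation). Used by the non-rational formal step: the model walk of a thread whose points have GROWING residue fields
is run over one algebraic closure `Ω`, each anchor's series being read in `Ω⟦y⟧` through the embedding of its coefficient field. OURS
bookkeeping about the tree's model; NOT a statement of H. Hironaka's manuscript [Hironaka2017], nothing of which is used. AI-written; AI review
is weaker than expert review. References: H. Hauser, Bull. AMS 47 (2010) §§F–G; V. Cossart, U. Jannsen, S. Saito (2020), proof of Thm. 3.10.
[Hauser2010] [CossartJannsenSaito2020] [folklore]
-/

noncomputable section

set_option linter.dupNamespace false -- mandated namespace of this single-conjunct summit

open MvPolynomial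

namespace Summit.ResolutionOfSingularities.ResolutionOfSingularities.Theorems

namespace CampaignW46

namespace MohWindowShadePS

open Literature.AlgebraicGeometry.Resolution
open Literature.AlgebraicGeometry.Resolution.PointBlowup
open Literature.AlgebraicGeometry.Resolution.Hauser2010
open MohWindowShadeFormalNR (order_map_of_injective)

variable {σ : Type*} [Fintype σ] [DecidableEq σ] {K K' : Type*} [Field K] [Field K'] (f : K →+* K')

/-! ## §1 Polynomial level -/

omit [Fintype σ] [DecidableEq σ] in
/-- Coercion to power series commutes with the coefficient map. [folklore] -/
theorem coe_map (P : MvPolynomial σ K) :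
    ((MvPolynomial.map f P : MvPolynomial σ K') : MvPowerSeries σ K') = MvPowerSeries.map f (P : MvPowerSeries σ K) := by
  ext e
  rw [MvPolynomial.coeff_coe, coeff_map, MvPowerSeries.coeff_map, MvPolynomial.coeff_coe]

omit [Fintype σ] [DecidableEq σ] in
/-- `ord₀ (F ⊗ K′) = ord₀ F`. [folklore] -/
theorem ordZero_map (P : MvPolynomial σ K) : ordZero (MvPolynomial.map f P) = ordZero P := by
  unfold ordZero
  rw [coe_map, order_map_of_injective f f.injective]

/-- Truncation commutes with the coefficient map. [folklore] -/
theorem truncTot_map (N : ℕ) (φ : MvPowerSeries σ K) : truncTot N (MvPowerSeries.map f φ) = MvPolynomial.map f (truncTot N φ) := by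
  ext e
  rw [coeff_truncTot, coeff_map, coeff_truncTot, MvPowerSeries.coeff_map]
  split_ifs
  · rfl
  · rw [map_zero]

omit [Fintype σ] in
/-- Deleting `p`-th power monomials commutes with the coefficient map. [folklore] -/
theorem deletePthPowers_map (p : ℕ) (P : MvPolynomial σ K) :
    deletePthPowers p (MvPolynomial.map f P) = MvPolynomial.map f (deletePthPowers p P) := by
  ext e
  rw [coeff_deletePthPowers, coeff_map, coeff_map, coeff_deletePthPowers]
  split_ifs
  · rw [map_zero]
  · rfl

variable [DecidableEq K] [DecidableEq K']

omit [Fintype σ] in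
/-- The new multiplicities at a rational point are unchanged by the coefficient map. [folklore] -/
theorem newMult_map (q : ℕ) (j : σ) (b : σ → K) (s : State σ K) :
    PointBlowup.newMult q j (f ∘ b) (⟨MvPolynomial.map f s.F, s.r⟩ : State σ K') = PointBlowup.newMult q j b s := by
  unfold PointBlowup.newMult
  have hfil : (s.r.filter fun i => (f ∘ b) i = 0) = s.r.filter fun i => b i = 0 := by
    have hp : (fun i => (f ∘ b) i = 0) = fun i => b i = 0 := by
      funext i; rw [Function.comp_apply, map_eq_zero_iff f f.injective]
    simp_rw [hp]
  rw [hfil, ordZero_map]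

omit [Fintype σ] in
/-- **The polynomial Hauser–Wagner step commutes with the coefficient map.** [cite: CossartJannsenSaito2020, proof of Thm. 3.10 (p. 50)] -/
theorem step_map (q : ℕ) (j : σ) (b : σ → K) (s : State σ K) :
    PointBlowup.step q j (f ∘ b) (⟨MvPolynomial.map f s.F, s.r⟩ : State σ K') =
      ⟨MvPolynomial.map f (PointBlowup.step q j b s).F, (PointBlowup.step q j b s).r⟩ := by
  unfold PointBlowup.step
  rw [pointTransform_map_ringHom, deletePthPowers_map, newMult_map]

/-! ## §2 Series level -/

omit [DecidableEq K] [DecidableEq K'] in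
/-- Truncation of a series state commutes with the coefficient map. [folklore] -/
theorem Series.trunc_map (N : ℕ) (S : Series σ K) :
    (⟨MvPowerSeries.map f S.F, S.r⟩ : Series σ K').trunc N = ⟨MvPolynomial.map f (S.trunc N).F, (S.trunc N).r⟩ := by
  unfold Series.trunc
  rw [truncTot_map]

omit [DecidableEq K] [DecidableEq K'] in
/-- The series point transform commutes with the coefficient map. [folklore] -/
theorem Series.pointTransform_map (q : ℕ) (j : σ) (b : σ → K) (S : Series σ K) :
    (⟨MvPowerSeries.map f S.F, S.r⟩ : Series σ K').pointTransform q j (f ∘ b) = MvPowerSeries.map f (S.pointTransform q j b) := by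
  ext E
  rw [MvPowerSeries.coeff_map]
  unfold Series.pointTransform
  rw [MvPowerSeries.coeff_apply, MvPowerSeries.coeff_apply, Series.trunc_map, pointTransform_map_ringHom, coeff_map]

omit [DecidableEq K] [DecidableEq K'] in
/-- **«Equimultiple point» is invariant under the coefficient map** (series states). [cite: CossartJannsenSaito2020, Def. 3.13 (1)] -/
theorem Series.isEquimultiplePoint_map_iff (q : ℕ) (j : σ) (b : σ → K) (S : Series σ K) :
    (⟨MvPowerSeries.map f S.F, S.r⟩ : Series σ K').IsEquimultiplePoint q j (f ∘ b) ↔ S.IsEquimultiplePoint q j b := by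
  unfold Series.IsEquimultiplePoint
  simp only [Series.pointTransform_map, MvPowerSeries.coeff_map, map_eq_zero_iff f f.injective]

/-- **The series Hauser–Wagner step commutes with the coefficient map** (residual series). [cite: Hauser2010, §§F–G (point blowup followed by cleaning)] -/
theorem Series.step_map_F (q : ℕ) (j : σ) (b : σ → K) (S : Series σ K) :
    ((⟨MvPowerSeries.map f S.F, S.r⟩ : Series σ K').step q j (f ∘ b)).F = MvPowerSeries.map f (S.step q j b).F := by
  ext E
  rw [MvPowerSeries.coeff_map]
  unfold Series.step
  dsimp only
  rw [MvPowerSeries.coeff_apply, MvPowerSeries.coeff_apply, Series.trunc_map, step_map, coeff_map]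

/-- The series step commutes with the coefficient map (multiplicities). [folklore] -/
theorem Series.step_map_r (q : ℕ) (j : σ) (b : σ → K) (S : Series σ K) :
    ((⟨MvPowerSeries.map f S.F, S.r⟩ : Series σ K').step q j (f ∘ b)).r = (S.step q j b).r := by
  unfold Series.step Series.newMult
  dsimp only
  have hfil : (S.r.filter fun i => (f ∘ b) i = 0) = S.r.filter fun i => b i = 0 := by
    have hp : (fun i => (f ∘ b) i = 0) = fun i => b i = 0 := by
      funext i; rw [Function.comp_apply, map_eq_zero_iff f f.injective]
    simp_rw [hp]
  rw [hfil, order_map_of_injective f f.injective]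

/-- **The series step commutes with the coefficient map.** [cite: Hauser2010, §§F–G (point blowup followed by cleaning)] -/
theorem Series.step_map (q : ℕ) (j : σ) (b : σ → K) (S : Series σ K) :
    (⟨MvPowerSeries.map f S.F, S.r⟩ : Series σ K').step q j (f ∘ b) = ⟨MvPowerSeries.map f (S.step q j b).F, (S.step q j b).r⟩ := by
  have hF := Series.step_map_F f q j b S
  have hr := Series.step_map_r f q j b S
  cases h : (⟨MvPowerSeries.map f S.F, S.r⟩ : Series σ K').step q j (f ∘ b) with
  | mk F' r' =>
    rw [h] at hF hr
    simp only at hF hr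
    rw [hF, hr]

omit [Fintype σ] [DecidableEq σ] [DecidableEq K] [DecidableEq K'] in
/-- Composition of coefficient maps on series states. [folklore] -/
theorem map_map_F {K'' : Type*} [Field K''] (g : K' →+* K'') (F : MvPowerSeries σ K) :
    MvPowerSeries.map g (MvPowerSeries.map f F) = MvPowerSeries.map (g.comp f) F := by
  ext e
  simp only [MvPowerSeries.coeff_map, RingHom.comp_apply]

end MohWindowShadePS

end CampaignW46

end Summit.ResolutionOfSingularities.ResolutionOfSingularities.Theorems

end
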